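import Literature.MathematicalPhysics.QuantumLattice.HubbardSectorPropagatorGram
import Literature.MathematicalPhysics.QuantumLattice.MatsubaraSectorPropagator
import Literature.Probability.LatticeModels.TorusMomentaInRotatedBox
import HarnessLib

/-!
# The sector phase-space count on the finite space-time dual torus (the Gram constant `κ_h² ≍ γ^{3h/2}` at finite `(β, L)`)

Topic `MathematicalPhysics/QuantumLattice`; the finite-`(β, L)` form of Benfatto–Giuliani–Mastropietro 2006, (2.80):
in the Gram representation of the sectorised propagators (`HubbardSectorPropagatorGram.lean`,
`contr C' X Y = ⟪F_X, G_Y⟫` with `‖F_X‖² = Σ_k ‖(βL²)⁻¹‖² ‖F_ω(k)‖² ‖p(k,σ)‖`, `norm_sq_sectorGramF`) the Gram constant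
`κ² = ‖F_X‖²` is the SUP of the symbol times the NUMBER of frequency–momenta in the support of the sector, divided by
`(βL²)²`; at scale `h` the support is `{|k₀| ≤ e₀γ^h} × (rotated box of sides γ^h × γ^{h/2})`, whose cardinality for
`β, L` large is `≍ (βγ^h)(L²γ^{3h/2})`, giving `κ² ≍ (βL²)⁻¹ γ^{-h} · γ^{5h/2} = γ^{3h/2}/(βL²)` — (2.80) in the
normalisation of the lattice fields.  PROVED here:

* `matsubaraFreq_eq_fermiMatsubara`, **`card_filter_matsubaraFreq_le`** — the number of kept Matsubara indices with
  `|ω_i| ≤ a` is at most `aβ/π + 3` (`card_fermiMatsubara_le` of `MatsubaraSectorPropagator.lean`);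
* **`card_filter_freqMomentum_le`** — for predicates on the frequency and on the spatial momentum separately the
  count multiplies; with `card_filter_momenta_frameBox_le` (`TorusMomentaInRotatedBox.lean`):
  `#{(i,k⃗) : |ω_i| ≤ a, k⃗ in the rotated box} ≤ (aβ/π + 3)(√2LB₁/π + 2)(√2LB₂/π + 2)`;
* `sum_le_card_mul_of_support`, **`norm_sq_sectorGramF_le`**, `norm_sq_sectorGramG_le` — `‖F_X‖², ‖G_Y‖² ≤
  ‖(βL²)⁻¹‖² · n · S` whenever `‖F_ω(k)‖²‖p(k,σ)‖ ≤ S` everywhere and vanishes off a set of at most `n` momenta.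

Everything is proved; no definitions, no named facts. [folklore]

## Sources

G. Benfatto, A. Giuliani, V. Mastropietro, Ann. Henri Poincaré 7 (2006) 809–898, §2.5 (2.50), §2.8 (2.80) and
footnote ¹ (`BenfattoGiulianiMastropietro2006`).
-/

noncomputable section

namespace Literature.MathematicalPhysics.QuantumLattice

open Finset Literature.Probability.LatticeModels
open scoped Real

variable {L M : ℕ}

/-! ### Counting Matsubara indices -/

/-- The kept frequencies are fermionic Matsubara frequencies: `ω_i = π(2 n_i + 1)/β`, `n_i = i - M`. [folklore] -/
theorem matsubaraFreq_eq_fermiMatsubara (β : ℝ) (i : MatsubaraIdx M) :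
    matsubaraFreq β M i = fermiMatsubara β (matsubaraInt M i) := rfl

/-- **Counting the kept Matsubara indices in a window**: `#{i : |ω_i| ≤ a} ≤ aβ/π + 3` (`β > 0`, `a ≥ 0`).
[cite: BenfattoGiulianiMastropietro2006, §2.3] -/
theorem card_filter_matsubaraFreq_le {β : ℝ} (hβ : 0 < β) {a : ℝ} (ha : 0 ≤ a) (S : Finset (MatsubaraIdx M))
    (hS : ∀ i ∈ S, |matsubaraFreq β M i| ≤ a) : (S.card : ℝ) ≤ a * β / π + 3 := by
  have hinj : Set.InjOn (matsubaraInt M) S := by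
    intro i _ j _ h
    simp only [matsubaraInt] at h
    exact Fin.ext (by omega)
  rw [← card_image_of_injOn hinj]
  refine card_fermiMatsubara_le hβ ha _ fun m hm => ?_
  obtain ⟨i, hi, rfl⟩ := mem_image.1 hm
  rw [← matsubaraFreq_eq_fermiMatsubara]
  exact hS i hi

/-! ### Counting frequency–momenta -/

/-- **The count multiplies**: for a predicate on the frequency index and one on the spatial momentum,
`#{(i,k⃗) : P i ∧ Q k⃗} = #{i : P i} · #{k⃗ : Q k⃗}`. [folklore] -/
theorem card_filter_freqMomentum_eq [NeZero L] (P : MatsubaraIdx M → Prop) (Q : TorusSite 2 L → Prop)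
    [DecidablePred P] [DecidablePred Q] :
    ((univ : Finset (FreqMomentum L M)).filter fun k => P k.1 ∧ Q k.2).card =
      ((univ : Finset (MatsubaraIdx M)).filter P).card * ((univ : Finset (TorusSite 2 L)).filter Q).card := by
  rw [← card_product, ← filter_product, univ_product_univ]

/-- **The sector phase-space count at finite `(β, L)`**: for `β > 0`, `a ≥ 0`, an orthonormal frame `(n, τ)`, a centre
`c` and half-sides `B₁, B₂ ≥ 0`,
`#{(i,k⃗) : |ω_i| ≤ a, |⟨2πk̃/L - c, n⟩| ≤ B₁, |⟨2πk̃/L - c, τ⟩| ≤ B₂} ≤ (aβ/π + 3)(√2LB₁/π + 2)(√2LB₂/π + 2)`.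
[cite: BenfattoGiulianiMastropietro2006, §2.5 (2.50) and footnote 1] -/
theorem card_filter_freqMomentum_le [NeZero L] {β : ℝ} (hβ : 0 < β) {a : ℝ} (ha : 0 ≤ a) {n τ : Fin 2 → ℝ}
    (hn : n 0 ^ 2 + n 1 ^ 2 = 1) (hτ : τ 0 ^ 2 + τ 1 ^ 2 = 1) (hnτ : n 0 * τ 0 + n 1 * τ 1 = 0) (c : Fin 2 → ℝ)
    {B₁ B₂ : ℝ} (hB₁ : 0 ≤ B₁) (hB₂ : 0 ≤ B₂) :
    ((((univ : Finset (FreqMomentum L M)).filter fun k => |matsubaraFreq β M k.1| ≤ a ∧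
        (|(2 * π * (((k.2 0).valMinAbs : ℤ) : ℝ) / L - c 0) * n 0 + (2 * π * (((k.2 1).valMinAbs : ℤ) : ℝ) / L - c 1) * n 1| ≤ B₁ ∧
          |(2 * π * (((k.2 0).valMinAbs : ℤ) : ℝ) / L - c 0) * τ 0 + (2 * π * (((k.2 1).valMinAbs : ℤ) : ℝ) / L - c 1) * τ 1| ≤ B₂)).card : ℕ) : ℝ) ≤
      (a * β / π + 3) * ((Real.sqrt 2 * L * B₁ / π + 2) * (Real.sqrt 2 * L * B₂ / π + 2)) := by
  classical
  rw [card_filter_freqMomentum_eq (fun i : MatsubaraIdx M => |matsubaraFreq β M i| ≤ a)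
    (fun k : TorusSite 2 L =>
      |(2 * π * (((k 0).valMinAbs : ℤ) : ℝ) / L - c 0) * n 0 + (2 * π * (((k 1).valMinAbs : ℤ) : ℝ) / L - c 1) * n 1| ≤ B₁ ∧
        |(2 * π * (((k 0).valMinAbs : ℤ) : ℝ) / L - c 0) * τ 0 + (2 * π * (((k 1).valMinAbs : ℤ) : ℝ) / L - c 1) * τ 1| ≤ B₂),
    Nat.cast_mul]
  refine mul_le_mul (card_filter_matsubaraFreq_le hβ ha _ fun i hi => (mem_filter.1 hi).2) ?_ (Nat.cast_nonneg _)
    (by positivity)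
  convert card_filter_momenta_frameBox_le L hn hτ hnτ c hB₁ hB₂ using 3

/-! ### The Gram constant -/

/-- A family bounded by `S` and vanishing off a set of at most `n` elements sums to at most `n · S`. [folklore] -/
theorem sum_le_card_mul_of_support {ι : Type*} [Fintype ι] (f : ι → ℝ) {S : ℝ} (hS : ∀ i, f i ≤ S)
    (T : Finset ι) (hT : ∀ i, f i ≠ 0 → i ∈ T) : ∑ i, f i ≤ T.card * S := by
  classical
  calc ∑ i, f i = ∑ i ∈ T, f i := by
        rw [← sum_subset (subset_univ T) fun i _ hi => ?_]
        by_contra h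
        exact hi (hT i h)
    _ ≤ ∑ _i ∈ T, S := sum_le_sum fun i _ => hS i
    _ = T.card * S := by rw [sum_const, nsmul_eq_mul]

section Gram

variable [NeZero L] {N : ℕ}

/-- **The Gram constant at finite `(β, L)`** (left vector): if `‖F_ω(k)‖² ‖p(k,σ)‖ ≤ S` for all `k` and this
product vanishes off a set `T` of momenta, then `‖F_X‖² ≤ ‖(βL²)⁻¹‖² · |T| · S` for every auxiliary label `X` of
sector `ω` and spin `σ` — the sup of the symbol times the sector phase-space count.
[cite: BenfattoGiulianiMastropietro2006, §2.8 (2.80)] -/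
theorem norm_sq_sectorGramF_le (β : ℝ) (F : Fin N → FreqMomentum L M → ℂ) (p : FreqMomentum L M × Fin 2 → ℂ)
    (Y : SpaceTimeIdx L M × SectorLeg N) {S : ℝ} (hS : ∀ k, ‖F Y.2.1.1 k‖ ^ 2 * ‖p (k, Y.2.1.2)‖ ≤ S)
    (T : Finset (FreqMomentum L M)) (hT : ∀ k, F Y.2.1.1 k ≠ 0 → p (k, Y.2.1.2) ≠ 0 → k ∈ T) :
    ‖sectorGramF L M β F p Y‖ ^ 2 ≤ ‖((1 / (β * (L : ℝ) ^ 2) : ℝ) : ℂ)‖ ^ 2 * (T.card * S) := by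
  rw [norm_sq_sectorGramF]
  simp_rw [mul_assoc]
  rw [← mul_sum]
  refine mul_le_mul_of_nonneg_left (sum_le_card_mul_of_support _ hS T fun k hk => ?_)
    (by positivity)
  refine hT k (fun h => hk ?_) (fun h => hk ?_)
  · rw [h, norm_zero, zero_pow two_ne_zero, zero_mul]
  · rw [h, norm_zero, mul_zero]

/-- **The Gram constant at finite `(β, L)`** (right vector). [cite: BenfattoGiulianiMastropietro2006, §2.8 (2.80)] -/
theorem norm_sq_sectorGramG_le (β : ℝ) (F : Fin N → FreqMomentum L M → ℂ) (p : FreqMomentum L M × Fin 2 → ℂ)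
    (Y' : SpaceTimeIdx L M × SectorLeg N) {S : ℝ} (hS : ∀ k, ‖F Y'.2.1.1 k‖ ^ 2 * ‖p (k, Y'.2.1.2)‖ ≤ S)
    (T : Finset (FreqMomentum L M)) (hT : ∀ k, F Y'.2.1.1 k ≠ 0 → p (k, Y'.2.1.2) ≠ 0 → k ∈ T) :
    ‖sectorGramG L M β F p Y'‖ ^ 2 ≤ ‖((1 / (β * (L : ℝ) ^ 2) : ℝ) : ℂ)‖ ^ 2 * (T.card * S) := by
  rw [norm_sq_sectorGramG]
  simp_rw [mul_assoc]
  rw [← mul_sum]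
  refine mul_le_mul_of_nonneg_left (sum_le_card_mul_of_support _ hS T fun k hk => ?_)
    (by positivity)
  refine hT k (fun h => hk ?_) (fun h => hk ?_)
  · rw [h, norm_zero, zero_pow two_ne_zero, zero_mul]
  · rw [h, norm_zero, mul_zero]

end Gram

end Literature.MathematicalPhysics.QuantumLattice
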